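import Summits.NavierStokesRegularity.NavierStokesRegularity.Theorems.PoloidalWindowDoorPoloidalWindowRigidityZShockNoetherLaws
import HarnessLib

/-!
# Crux K2 `PoloidalWindowRigidity` (stmt-NavierStokesRegularity-19708), line `z_shock` — the VIRIAL (dilation / Morawetz) LAW of the
# autonomous height-evolution and its signed bulk term

`--supports stmt-NavierStokesRegularity-19708 --as helper` (leafhand-ns-poloidalwindowdoor-3 g11, cell decomp-ns, 2026-08-31).  Class-free,
def-free, Mathlib + one tree file (for its imports only).  **No stub and no summit is closed by this file; Navier–Stokes regularity is NOT
proved here (rung 0).**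

WHY THIS FILE.  The R3 core of the deciding stub `stub_zShockThickAut` (card `Cruxes/PoloidalWindowRigidity/Lines/z_shock.md`, §Hardest stub)
is two-sided eternal rigidity for the autonomous height-evolution of a slice, written in the height `s` (= `x₂`) and the horizontal variable
`y ∈ ℝ²`: `∂ₛu_b = ∂_b Γ(w) = G(w) ∂_b w` (frozen slope law, `G = Γ'` the slope), `∂ₛw = −(∂₀u₀ + ∂₁u₁)` (incompressibility),
`∂₁u₀ = ∂₀u₁` (poloidality, `u = ∇ₕφ`).  The tree holds its translation Noether laws (`…ZShockNoetherLaws`, p825599: energy and horizontal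
momentum) and the wave-energy budget.  This file adds the law generated by the remaining (broken) symmetry, DILATION `(s, y) ↦ (λs, λy)` —
the virial / Morawetz identity — whose bulk term is SIGNED under hyperbolicity alone:

* `virialLaw_pointwise` — for slices differentiable at `y`, time-lines differentiable at `s`, and any `Θ` with `Θ'(r) = (r − w⋆)·G(r)` at the
  value `r = w(s,y)` (`w⋆` an arbitrary reference level):

    `∂ₛ[(y·u)(w − w⋆)] + Σᵢ ∂ᵢ[(y·u) uᵢ − ½|u|² yᵢ − Θ(w) yᵢ] = −2 Θ(w)`   at `(s, y)`

  (three-line hand computation: `∂ₛ` of the moment `(y·u)(w−w⋆)` is `(w−w⋆) y·∇Γ(w) − (y·u) div u`; the first term is `y·∇Θ(w) =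
  div(Θ y) − 2Θ`, the second is `div((y·u)u − ½|u|²y)` by poloidality; in `n` horizontal dimensions the bulk would be `−nΘ(w) + (1 − n/2)|u|²`,
  and `n = 2` is the dimension of the crux).
* `theta_le_neg_sq` / `theta_ge_neg_sq` / `theta_nonpos` — if `Θ(w⋆) = 0`, `Θ' (r) = (r − w⋆)G(r)` and `G ≤ −γlo` (resp. `−γhi ≤ G`) on `ℝ`, then
  `Θ(r) ≤ −(γlo/2)(r − w⋆)²` (resp. `Θ(r) ≥ −(γhi/2)(r − w⋆)²`): on a HYPERBOLIC column (`G ≤ −γlo < 0`) the bulk `−2Θ(w) ≥ γlo (w − w⋆)²` is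
  positive definite in `w − w⋆` — no genuine nonlinearity is used.
* `abs_fluxMoment_le` — the radial flux moment obeys `|Σᵢ yᵢ fᵢ| ≤ |y|²·(³⁄₂|u|² + (γhi/2)(w − w⋆)²)` (Cauchy–Schwarz), the input of the
  tail estimate in the sequel `…ZShockNoLocalizedBreather` (no horizontally localised height-periodic patterns).

Honest scope: an exact kinematic identity (poloidal + divergence-free + slope law) and two calculus inequalities; S-sized; it proves no rigidity by
itself.  presearch: «nonexistence of spatially localised time-periodic solutions (breathers) by a virial identity» → [corpus:
book:knowles1987-differential-equations-mathematical-physics-proceedings pp.402–409: P.-A. Vuillermot, breather non-existence for SEMILINEAR Klein–Gordon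
equations on `ℝ × ℝ` by period/virial conditions; refs Coron, C. R. Acad. Sci. A294 (1982) 127–129; Vuillermot, Comment. Math. Helv. (1987)] — nearest
prior art (semilinear, one space dimension); the identity below is its quasilinear, first-order-system, two-space-dimension analogue for the poloidal
height-evolution and is a three-line computation (no source states it; galaxy «virial identity|Morawetz estimate|dilation identity» --star all: dispersive /
Kerr hits only; tree `rg -i "virial|Morawetz|breather"` over the `PoloidalWindowDoorPoloidalWindowRigidity*` shelf: no hit). [folklore]
-/

noncomputable section

namespace Summit.NavierStokesRegularity.NavierStokesRegularity.Theorems.PoloidalWindowDoorPoloidalWindowRigidityZShockVirialLaw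

-- the summit and its single sub-problem share the name (CONVENTIONS §1)
set_option linter.dupNamespace false

open Set Filter Topology

/-! ### The signed bulk term -/

/-- **Upper bound of the virial potential.**  If `Θ(w⋆) = 0`, `Θ'(r) = (r − w⋆)·G(r)` and `G ≤ −γlo` everywhere, then
`Θ(r) ≤ −(γlo/2)(r − w⋆)²` (the function `Θ + (γlo/2)(· − w⋆)²` is non-increasing right of `w⋆` and non-decreasing left of it). [folklore] -/
theorem theta_le_neg_sq {Θ G : ℝ → ℝ} {wstar γlo : ℝ} (hΘ : ∀ r, HasDerivAt Θ ((r - wstar) * G r) r)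
    (hΘ0 : Θ wstar = 0) (hG : ∀ r, G r ≤ -γlo) (r : ℝ) :
    Θ r ≤ -(γlo / 2) * (r - wstar) ^ 2 := by
  set φ : ℝ → ℝ := fun r => Θ r + γlo / 2 * (r - wstar) ^ 2 with hφ
  have hφd : ∀ r, HasDerivAt φ ((r - wstar) * (G r + γlo)) r := by
    intro r
    have h1 : HasDerivAt (fun r => (r - wstar) ^ 2) (((2 : ℕ) : ℝ) * (r - wstar) ^ (2 - 1) * 1) r :=
      ((hasDerivAt_id r).sub_const wstar).pow 2
    have h := (hΘ r).add (h1.const_mul (γlo / 2))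
    refine h.congr_deriv ?_
    push_cast
    ring
  have hφc : Continuous φ := continuous_iff_continuousAt.2 fun r => (hφd r).continuousAt
  have hφ0 : φ wstar = 0 := by simp [hφ, hΘ0]
  have hderiv : ∀ r, deriv φ r = (r - wstar) * (G r + γlo) := fun r => (hφd r).deriv
  suffices h : φ r ≤ 0 by
    have : φ r = Θ r + γlo / 2 * (r - wstar) ^ 2 := rfl
    linarith
  rcases le_total wstar r with hr | hr
  · -- right of `w⋆`: non-increasing
    have hanti : AntitoneOn φ (Ici wstar) :=
      antitoneOn_of_deriv_nonpos (convex_Ici wstar) hφc.continuousOn (fun x _ => (hφd x).differentiableAt.differentiableWithinAt)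
        (fun x hx => by
          rw [interior_Ici] at hx
          rw [hderiv]
          have h1 : 0 ≤ x - wstar := by linarith [le_of_lt (mem_Ioi.1 hx)]
          have h2 : G x + γlo ≤ 0 := by linarith [hG x]
          exact mul_nonpos_iff.2 (Or.inl ⟨h1, h2⟩))
    have := hanti (self_mem_Ici (a := wstar)) (mem_Ici.2 hr) hr
    linarith
  · -- left of `w⋆`: non-decreasing
    have hmono : MonotoneOn φ (Iic wstar) :=
      monotoneOn_of_deriv_nonneg (convex_Iic wstar) hφc.continuousOn (fun x _ => (hφd x).differentiableAt.differentiableWithinAt)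
        (fun x hx => by
          rw [interior_Iic] at hx
          rw [hderiv]
          have h1 : x - wstar ≤ 0 := by linarith [le_of_lt (mem_Iio.1 hx)]
          have h2 : G x + γlo ≤ 0 := by linarith [hG x]
          exact mul_nonneg_of_nonpos_of_nonpos h1 h2)
    have := hmono (mem_Iic.2 hr) (self_mem_Iic (a := wstar)) hr
    linarith

/-- **Lower bound of the virial potential.**  If `Θ(w⋆) = 0`, `Θ'(r) = (r − w⋆)·G(r)` and `−γhi ≤ G` everywhere, then
`−(γhi/2)(r − w⋆)² ≤ Θ(r)`. [folklore] -/
theorem theta_ge_neg_sq {Θ G : ℝ → ℝ} {wstar γhi : ℝ} (hΘ : ∀ r, HasDerivAt Θ ((r - wstar) * G r) r)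
    (hΘ0 : Θ wstar = 0) (hG : ∀ r, -γhi ≤ G r) (r : ℝ) :
    -(γhi / 2) * (r - wstar) ^ 2 ≤ Θ r := by
  have h := theta_le_neg_sq (Θ := -Θ) (G := -G) (wstar := wstar) (γlo := -γhi)
    (fun r => ((hΘ r).neg).congr_deriv (by rw [Pi.neg_apply]; ring)) (by rw [Pi.neg_apply, hΘ0, neg_zero])
    (fun r => by rw [Pi.neg_apply]; linarith [hG r]) r
  rw [Pi.neg_apply] at h
  linarith

/-- On a hyperbolic column (`G ≤ 0`) the virial potential is non-positive. [folklore] -/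
theorem theta_nonpos {Θ G : ℝ → ℝ} {wstar : ℝ} (hΘ : ∀ r, HasDerivAt Θ ((r - wstar) * G r) r)
    (hΘ0 : Θ wstar = 0) (hG : ∀ r, G r ≤ 0) (r : ℝ) : Θ r ≤ 0 := by
  have h := theta_le_neg_sq (γlo := 0) hΘ hΘ0 (fun r => by simpa using hG r) r
  simpa using h

/-- **Two-sided comparison of the bulk term**: `γlo (r − w⋆)² ≤ −2Θ(r) ≤ γhi (r − w⋆)²` under `−γhi ≤ G ≤ −γlo`. [folklore] -/
theorem bulk_bounds {Θ G : ℝ → ℝ} {wstar γlo γhi : ℝ} (hΘ : ∀ r, HasDerivAt Θ ((r - wstar) * G r) r)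
    (hΘ0 : Θ wstar = 0) (hGlo : ∀ r, G r ≤ -γlo) (hGhi : ∀ r, -γhi ≤ G r) (r : ℝ) :
    γlo * (r - wstar) ^ 2 ≤ -2 * Θ r ∧ -2 * Θ r ≤ γhi * (r - wstar) ^ 2 := by
  have h1 := theta_le_neg_sq hΘ hΘ0 hGlo r
  have h2 := theta_ge_neg_sq hΘ hΘ0 hGhi r
  constructor <;> linarith

/-! ### The pointwise virial law -/

section Pointwise

/-- Components of the standard basis vectors of `ℝ²` under the coordinate projections. -/
theorem proj_single (i j : Fin 2) :
    (EuclideanSpace.proj (𝕜 := ℝ) i) (EuclideanSpace.single j (1 : ℝ) : EuclideanSpace ℝ (Fin 2)) = if i = j then 1 else 0 := by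
  rw [show (EuclideanSpace.proj (𝕜 := ℝ) i) (EuclideanSpace.single j (1 : ℝ) : EuclideanSpace ℝ (Fin 2)) = (EuclideanSpace.single j (1 : ℝ) : EuclideanSpace ℝ (Fin 2)) i from rfl]
  simp [PiLp.single_apply]

/-- ★ **The virial (dilation / Morawetz) law of the autonomous height-evolution, pointwise.**  Horizontal field `u = (u₀, u₁)` and height
profile `w` on `ℝ_s × ℝ²_y`; at the point `(s, y)`: slices differentiable at `y`, time-lines differentiable at `s` with the frozen slope law
`∂ₛu_i = G(w)·∂ᵢw` and incompressibility `∂ₛw = −(∂₀u₀ + ∂₁u₁)`, poloidality `∂₁u₀ = ∂₀u₁`, and `Θ'(w) = (w − w⋆)·G(w)` at the value.  Then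

  `∂ₛ[(y·u)(w − w⋆)] + Σᵢ ∂ᵢ[(y·u)uᵢ − ½|u|² yᵢ − Θ(w) yᵢ] = −2Θ(w)`. [folklore] -/
theorem virialLaw_pointwise {u : Fin 2 → ℝ → EuclideanSpace ℝ (Fin 2) → ℝ} {w : ℝ → EuclideanSpace ℝ (Fin 2) → ℝ} {G Θ : ℝ → ℝ} {wstar s : ℝ} {y : EuclideanSpace ℝ (Fin 2)}
    (hu : ∀ i, DifferentiableAt ℝ (u i s) y) (hw : DifferentiableAt ℝ (w s) y)
    (hΘ : HasDerivAt Θ ((w s y - wstar) * G (w s y)) (w s y))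
    (hus : ∀ i, HasDerivAt (fun s' => u i s' y) (G (w s y) * fderiv ℝ (w s) y (EuclideanSpace.single i 1)) s)
    (hws : HasDerivAt (fun s' => w s' y)
      (-(fderiv ℝ (u 0 s) y (EuclideanSpace.single 0 1) + fderiv ℝ (u 1 s) y (EuclideanSpace.single 1 1))) s)
    (hpol : fderiv ℝ (u 0 s) y (EuclideanSpace.single 1 1) = fderiv ℝ (u 1 s) y (EuclideanSpace.single 0 1)) :
    deriv (fun s' => (y 0 * u 0 s' y + y 1 * u 1 s' y) * (w s' y - wstar)) s +
      ∑ i : Fin 2, fderiv ℝ (fun y' : EuclideanSpace ℝ (Fin 2) =>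
          (y' 0 * u 0 s y' + y' 1 * u 1 s y') * u i s y' - (1 / 2) * (u 0 s y' ^ 2 + u 1 s y' ^ 2) * y' i
            - Θ (w s y') * y' i) y (EuclideanSpace.single i 1)
      = -2 * Θ (w s y) := by
  set e0 : EuclideanSpace ℝ (Fin 2) := EuclideanSpace.single 0 1 with he0
  set e1 : EuclideanSpace ℝ (Fin 2) := EuclideanSpace.single 1 1 with he1
  -- the time derivative of the moment
  have ht : HasDerivAt (fun s' => (y 0 * u 0 s' y + y 1 * u 1 s' y) * (w s' y - wstar))
      ((y 0 * (G (w s y) * fderiv ℝ (w s) y e0) + y 1 * (G (w s y) * fderiv ℝ (w s) y e1)) * (w s y - wstar)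
        + (y 0 * u 0 s y + y 1 * u 1 s y) * (-(fderiv ℝ (u 0 s) y e0 + fderiv ℝ (u 1 s) y e1))) s :=
    (((hus 0).const_mul (y 0)).add ((hus 1).const_mul (y 1))).mul (hws.sub_const wstar)
  rw [ht.deriv]
  -- coordinate functions and slices at `y`
  have hc : ∀ i : Fin 2, HasFDerivAt (fun y' : EuclideanSpace ℝ (Fin 2) => y' i) (EuclideanSpace.proj (𝕜 := ℝ) i) y := fun i =>
    (EuclideanSpace.proj (𝕜 := ℝ) i).hasFDerivAt
  have hU : ∀ i : Fin 2, HasFDerivAt (u i s) (fderiv ℝ (u i s) y) y := fun i => (hu i).hasFDerivAt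
  have hW : HasFDerivAt (w s) (fderiv ℝ (w s) y) y := hw.hasFDerivAt
  have hΘW : HasFDerivAt (fun y' => Θ (w s y')) (((w s y - wstar) * G (w s y)) • fderiv ℝ (w s) y) y :=
    hΘ.comp_hasFDerivAt y hW
  -- the common factors
  have hyu : HasFDerivAt (fun y' : EuclideanSpace ℝ (Fin 2) => y' 0 * u 0 s y' + y' 1 * u 1 s y') _ y :=
    ((hc 0).mul (hU 0)).add ((hc 1).mul (hU 1))
  have hke : HasFDerivAt (fun y' : EuclideanSpace ℝ (Fin 2) => (1 / 2 : ℝ) * (u 0 s y' ^ 2 + u 1 s y' ^ 2)) _ y :=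
    (((hU 0).pow 2).add ((hU 1).pow 2)).const_mul (1 / 2 : ℝ)
  -- the two flux components
  have hF0 : HasFDerivAt (fun y' : EuclideanSpace ℝ (Fin 2) =>
      (y' 0 * u 0 s y' + y' 1 * u 1 s y') * u 0 s y' - (1 / 2) * (u 0 s y' ^ 2 + u 1 s y' ^ 2) * y' 0
        - Θ (w s y') * y' 0) _ y :=
    ((hyu.mul (hU 0)).sub (hke.mul (hc 0))).sub (hΘW.mul (hc 0))
  have hF1 : HasFDerivAt (fun y' : EuclideanSpace ℝ (Fin 2) =>
      (y' 0 * u 0 s y' + y' 1 * u 1 s y') * u 1 s y' - (1 / 2) * (u 0 s y' ^ 2 + u 1 s y' ^ 2) * y' 1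
        - Θ (w s y') * y' 1) _ y :=
    ((hyu.mul (hU 1)).sub (hke.mul (hc 1))).sub (hΘW.mul (hc 1))
  rw [Fin.sum_univ_two, hF0.fderiv, hF1.fderiv]
  simp only [_root_.sub_apply, _root_.add_apply, _root_.smul_apply, smul_eq_mul, nsmul_eq_mul, ← he0, ← he1]
  have hp : ∀ i j : Fin 2, (EuclideanSpace.proj (𝕜 := ℝ) i) (EuclideanSpace.single j (1 : ℝ) : EuclideanSpace ℝ (Fin 2)) = if i = j then 1 else 0 :=
    proj_single
  simp only [he0, he1, hp] 
  simp only [← he0, ← he1]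
  norm_num
  linear_combination (y 0 * u 1 s y - y 1 * u 0 s y) * hpol

end Pointwise

/-! ### The radial flux moment -/

/-- **Bound of the radial flux moment.**  With `fᵢ = (y·u)uᵢ − ½|u|²yᵢ − Θ yᵢ` one has `Σᵢ yᵢfᵢ = (y·u)² − ½|u|²|y|² − Θ|y|²`, hence, when
`−(γhi/2) d² ≤ Θ ≤ 0` (the virial potential at the value, `d = w − w⋆`),
`|Σᵢ yᵢ fᵢ| ≤ |y|²·(³⁄₂|u|² + (γhi/2) d²)`. [folklore] -/
theorem abs_fluxMoment_le (y0 y1 u0 u1 T d γhi : ℝ) (hT0 : T ≤ 0) (hT : -(γhi / 2) * d ^ 2 ≤ T) :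
    |y0 * ((y0 * u0 + y1 * u1) * u0 - (1 / 2) * (u0 ^ 2 + u1 ^ 2) * y0 - T * y0)
        + y1 * ((y0 * u0 + y1 * u1) * u1 - (1 / 2) * (u0 ^ 2 + u1 ^ 2) * y1 - T * y1)|
      ≤ (y0 ^ 2 + y1 ^ 2) * ((3 / 2) * (u0 ^ 2 + u1 ^ 2) + (γhi / 2) * d ^ 2) := by
  have e : y0 * ((y0 * u0 + y1 * u1) * u0 - (1 / 2) * (u0 ^ 2 + u1 ^ 2) * y0 - T * y0)
        + y1 * ((y0 * u0 + y1 * u1) * u1 - (1 / 2) * (u0 ^ 2 + u1 ^ 2) * y1 - T * y1)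
      = (y0 * u0 + y1 * u1) ^ 2 - (1 / 2) * (u0 ^ 2 + u1 ^ 2) * (y0 ^ 2 + y1 ^ 2) - T * (y0 ^ 2 + y1 ^ 2) := by ring
  rw [e, abs_le]
  have hcs : (y0 * u0 + y1 * u1) ^ 2 ≤ (y0 ^ 2 + y1 ^ 2) * (u0 ^ 2 + u1 ^ 2) := by
    nlinarith [sq_nonneg (y0 * u1 - y1 * u0)]
  have hy : 0 ≤ y0 ^ 2 + y1 ^ 2 := by positivity
  have hu : 0 ≤ u0 ^ 2 + u1 ^ 2 := by positivity
  have hsq : 0 ≤ (y0 * u0 + y1 * u1) ^ 2 := sq_nonneg _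
  constructor
  · nlinarith [mul_nonneg hy hu, mul_le_mul_of_nonneg_left hT hy]
  · nlinarith [mul_nonneg hy hu, mul_nonpos_of_nonneg_of_nonpos hy hT0]

end Summit.NavierStokesRegularity.NavierStokesRegularity.Theorems.PoloidalWindowDoorPoloidalWindowRigidityZShockVirialLaw

end
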